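/-
Copyright: the b2b-balaban T⁴-continuum CRUX team, row NE7b OWNER lineage `t4-ne7b-p1` (gen 134). Project licence.
-/
import Summits.QuantumFields.BalabanUV.T4Continuum.Spine.NE7b.SupPolymerLogZMeasurable
import Summits.QuantumFields.BalabanUV.T4Continuum.Spine.NE7b.SupOutputSmallFieldLetter

/-!
# THE NEXT POTENTIAL'S SUPPORT TERMS ARE MEASURABLE IN THE EXTERNAL FIELD, AND MEASURABLE IN THE CELLS OF THEIR SUPPORT — SCOPING-d6 (L5), road
# half: for set factors `f_X` Borel-measurable on the field space and an s-finite reference measure `μ` on `EuclideanSpace ℝ ι`, every shifted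
# resummed activity `ψ ↦ z_ψ(Y') = Σ_{⋃𝒜=Y'}∫∏_{X∈𝒜}f_X(ω+ψ)dμ(ω)` is measurable (Fubini's measurability half), hence by (369) so is every support
# term `ψ ↦ K⁺_Y(ψ)`; and when the factors are LOCAL in the field, `K⁺_Y = K⁺_Y ∘ (cut-off to the cells of Y)` ((355)∕(363)) with the cut-off
# measurable from the JOIN σ-algebra `⨆_{p∈Y}σ(ψ|_{cell p})` — so `K⁺_Y` is measurable in the cells of `Y`: the hypothesis `hmeas` of (355) for the
# NEXT step's factors `e^{K⁺_Y} − 1` (row NE7b, node U5c; (369) + Mathlib's `StronglyMeasurable.integral_prod_right`, `WithLp.measurable_toLp`,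
# `measurable_pi_lambda`, `comap_measurable` BY NAME; [folklore])

Cell `pub-balaban`, sub-cell `t4`, spine estimate NE7b (`T4WeightBudget.RelWeightBound`; the cell's OWN estimate — NOT PRINTED in
[Bałaban 1983–89], NOT PROVED).  Crux-route work under `Spine/NE7b/` by the row OWNER (`t4-ne7b-p1` gen 134, file (370)) under FREEZE
(0)'s crux-prover clause, on `g134/records/SCOPING-d6-iteration.md` (L5); NOTHING of Bałaban's is named as a Lean object, valued or asserted; no
`T4Continuum/Support` leaf typed; no `def`, no notation; zero `sorry`.  Imports (BY NAME): the OWNER's (369) `…SupPolymerLogZMeasurable`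
(`measurable_supportSum_of_coords`), (363) `…SupOutputSmallFieldLetter` (`cutoffField_eq_on`) and through it (355) (`step_supportTerm_local`), (348)
(`le_of_sets`); Mathlib's `StronglyMeasurable.integral_prod_right`, `Finset.measurable_sum∕prod`, `WithLp.measurable_toLp`, `measurable_pi_lambda`,
`measurable_pi_apply`, `comap_measurable`, `Complex.measurable_exp`.

WHAT IS PROVED ([folklore]; `z_ψ`, `K⁺_Y(ψ)` displayed as in (355)):
* §1 **`measurable_shiftedActivity`** (`ψ ↦ z_ψ(Y')` measurable for Borel-measurable factors and an s-finite `μ`), **`measurable_supportTerm`**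
  (`ψ ↦ K⁺_Y(ψ)` measurable), `measurable_nextFactor` (`ψ ↦ e^{K⁺_Y(ψ)} − 1` measurable);
* §2 **`measurable_cutoffField`** (the cut-off `ψ ↦ ψ·1_{cells Y}` is measurable from `⨆_{p∈Y}σ(ψ|_{cell p})` to the Borel σ-algebra), THE END
  **`measurable_supportTerm_cells`** (factors local in the field ⟹ `ψ ↦ K⁺_Y(ψ)` is `⨆_{p∈Y}σ(ψ|_{cell p})`-measurable) and
  `measurable_nextFactor_cells`; §3 toy.

HONEST (what this is NOT).  Measurability only; the regulated growth of the output singletons (L4) and the analytic half of NC-NE7b-α are untouched;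
scalar skeleton ((A3)); nothing of Bałaban's asserted.  BY-NAME EFFECT ON THE WALL: NONE.  NE7b NOT PRINTED ∕ NOT PROVED; spine PROVED 0∕9; rung (B)+1 —
the programme's measures remain FINITE-torus statements; NOT the mass gap, NOT Clay.  HONEST DEPENDENCY: continuum YM on T⁴ ⇐ BetaPertH ∧ nine spine
estimates (0∕9 proved); BetaPertH ⇐ (D1) ∧ (D4) ∧ CAP+tail; G-an2-4 gates asym, D1 and NE2∕3∕4.
-/

set_option autoImplicit false

noncomputable section

namespace Summit.QuantumFields.BalabanUV.T4Continuum.NE7b.SupRoadSupportTermMeasurable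

open MeasureTheory Finset
open scoped BigOperators
open Literature.Probability.LatticeModels
open SupPolymerLogZMeasurable (measurable_supportSum_of_coords)
open SupOutputSmallFieldLetter (cutoffField_eq_on)
open SupPolymerLocalStep (step_supportTerm_local)

variable {V : Type*} [DecidableEq V] {R : V → V → Prop} [DecidableRel R]
variable {ι : Type} [Fintype ι] [DecidableEq ι]

/-! ## §1. Measurability in the external field -/

omit [DecidableRel R] [DecidableEq ι] in
/-- **THE SHIFTED RESUMMED ACTIVITY IS MEASURABLE IN THE EXTERNAL FIELD**: set factors Borel-measurable on the field space, `μ` s-finite ⟹ for every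
cell set `Y'`, `ψ ↦ z_ψ(Y') = Σ_{𝒜 ∈ 𝒫(𝒳), ⋃𝒜 = Y'}∫∏_{X∈𝒜}f_X(ω + ψ)dμ(ω)` is measurable (Fubini's measurability half). [folklore] -/
theorem measurable_shiftedActivity (μ : Measure (EuclideanSpace ℝ ι)) [SFinite μ] {f : Finset V → EuclideanSpace ℝ ι → ℂ}
    (hf : ∀ X, Measurable (f X)) (𝒳 : Finset (Finset V)) (Y' : Finset V) :
    Measurable fun ψ : EuclideanSpace ℝ ι =>
      pushforwardActivity (fun 𝒜 : Finset (Finset V) => 𝒜.biUnion id) (cellActivity μ fun X ω => f X (ω + ψ))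
        (rconnSubsets (Touches R) 𝒳) Y' := by
  simp only [pushforwardActivity_apply]
  refine Finset.measurable_sum _ fun 𝒜 _ => ?_
  unfold cellActivity
  have hF : Measurable (Function.uncurry fun (ψ : EuclideanSpace ℝ ι) (ω : EuclideanSpace ℝ ι) => ∏ X ∈ 𝒜, f X (ω + ψ)) :=
    Finset.measurable_prod _ fun X _ => (hf X).comp (measurable_snd.add measurable_fst)
  exact (hF.stronglyMeasurable.integral_prod_right (ν := μ)).measurable

omit [DecidableEq ι] in
/-- **THE SUPPORT TERMS ARE MEASURABLE IN THE EXTERNAL FIELD**: `ψ ↦ K⁺_Y(ψ)` is measurable (Borel-measurable factors, s-finite `μ`; (369)). [folklore] -/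
theorem measurable_supportTerm (μ : Measure (EuclideanSpace ℝ ι)) [SFinite μ] {f : Finset V → EuclideanSpace ℝ ι → ℂ}
    (hf : ∀ X, Measurable (f X)) (𝒳 : Finset (Finset V)) (Y : Finset V) :
    Measurable fun ψ : EuclideanSpace ℝ ι =>
      ∑ 𝒞 ∈ ((rconnSubsets (Touches R) 𝒳).image fun 𝒜 => 𝒜.biUnion id).powerset with 𝒞.biUnion id = Y,
        truncatedWeight (GeomInc R) (pushforwardActivity (fun 𝒜 : Finset (Finset V) => 𝒜.biUnion id)
          (cellActivity μ fun X ω => f X (ω + ψ)) (rconnSubsets (Touches R) 𝒳)) 𝒞 :=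
  measurable_supportSum_of_coords (inc := GeomInc R) (fun Y' => measurable_shiftedActivity (R := R) μ hf 𝒳 Y') _ _

omit [DecidableEq ι] in
/-- **The next Mayer factor `ψ ↦ e^{K⁺_Y(ψ)} − 1` is measurable.** [folklore] -/
theorem measurable_nextFactor (μ : Measure (EuclideanSpace ℝ ι)) [SFinite μ] {f : Finset V → EuclideanSpace ℝ ι → ℂ}
    (hf : ∀ X, Measurable (f X)) (𝒳 : Finset (Finset V)) (Y : Finset V) :
    Measurable fun ψ : EuclideanSpace ℝ ι => Complex.exp
      (∑ 𝒞 ∈ ((rconnSubsets (Touches R) 𝒳).image fun 𝒜 => 𝒜.biUnion id).powerset with 𝒞.biUnion id = Y,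
        truncatedWeight (GeomInc R) (pushforwardActivity (fun 𝒜 : Finset (Finset V) => 𝒜.biUnion id)
          (cellActivity μ fun X ω => f X (ω + ψ)) (rconnSubsets (Touches R) 𝒳)) 𝒞) - 1 :=
  (Complex.measurable_exp.comp (measurable_supportTerm (R := R) μ hf 𝒳 Y)).sub measurable_const

/-! ## §2. Measurability in the cells of the support -/

omit [DecidableEq V] [DecidableRel R] [Fintype ι] in
/-- **THE CUT-OFF FIELD IS MEASURABLE FROM THE JOIN σ-ALGEBRA OF THE CELLS OF `Y`**: `ψ ↦ ψ·1_{⋃_{p∈Y}cell p}` is measurable from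
`⨆_{p∈Y}σ(ψ|_{cell p})` to the Borel σ-algebra (each coordinate in a cell of `Y` is read off the restriction to that cell; the others are `0`). [folklore] -/
theorem measurable_cutoffField (cell : V → Finset ι) (Y : Finset V) :
    Measurable[⨆ p ∈ Y, MeasurableSpace.comap (fun (ω : EuclideanSpace ℝ ι) (x : cell p) => ω x) inferInstance]
      (fun ψ : EuclideanSpace ℝ ι => (WithLp.toLp 2 (fun x => if x ∈ Y.biUnion cell then ψ x else 0) : EuclideanSpace ℝ ι)) := by
  -- coordinatewise: each coordinate of the cut-off field is measurable for the join σ-algebra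
  have hcoord : ∀ x : ι, Measurable[⨆ p ∈ Y, MeasurableSpace.comap (fun (ω : EuclideanSpace ℝ ι) (x : cell p) => ω x) inferInstance]
      (fun ψ : EuclideanSpace ℝ ι => if x ∈ Y.biUnion cell then ψ x else (0 : ℝ)) := by
    intro x
    by_cases hx : x ∈ Y.biUnion cell
    · simp only [hx, if_true]
      obtain ⟨p, hp, hxp⟩ := mem_biUnion.1 hx
      have h1 : Measurable[MeasurableSpace.comap (fun (ω : EuclideanSpace ℝ ι) (y : cell p) => ω y) inferInstance, inferInstance]
          (fun (ω : EuclideanSpace ℝ ι) (y : cell p) => ω y) := comap_measurable _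
      have h2 : Measurable (fun φ : cell p → ℝ => φ ⟨x, hxp⟩) := measurable_pi_apply _
      exact (h2.comp h1).mono (le_iSup₂ (f := fun p (_ : p ∈ Y) =>
        MeasurableSpace.comap (fun (ω : EuclideanSpace ℝ ι) (y : cell p) => ω y) inferInstance) p hp) le_rfl
    · simp only [hx, if_false]
      exact measurable_const
  -- assemble: the σ-algebra of `EuclideanSpace` is the comap under `ofLp` of the product σ-algebra
  rw [measurable_iff_comap_le]
  change MeasurableSpace.comap _ (MeasurableSpace.comap WithLp.ofLp (⨆ x : ι, MeasurableSpace.comap (fun b : ι → ℝ => b x) inferInstance)) ≤ _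
  rw [MeasurableSpace.comap_comp, MeasurableSpace.comap_iSup]
  refine iSup_le fun x => ?_
  rw [MeasurableSpace.comap_comp]
  exact measurable_iff_comap_le.1 (hcoord x)

/-- **THE END — THE SUPPORT TERMS ARE MEASURABLE IN THE CELLS OF THEIR SUPPORT**: factors Borel-measurable and LOCAL in the field (`ψ = ψ'` on the
cells of `X` ⟹ `f_X(ω+ψ) = f_X(ω+ψ')`), `μ` s-finite ⟹ `ψ ↦ K⁺_Y(ψ)` is measurable for `⨆_{p∈Y}σ(ψ|_{cell p})` — (355)'s `hmeas` for the next step's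
factors, by locality + the measurable cut-off. [folklore] -/
theorem measurable_supportTerm_cells (μ : Measure (EuclideanSpace ℝ ι)) [SFinite μ] (cell : V → Finset ι)
    {f : Finset V → EuclideanSpace ℝ ι → ℂ} (hf : ∀ X, Measurable (f X)) (𝒳 : Finset (Finset V))
    (hloc : ∀ X ∈ 𝒳, ∀ (ω ψ ψ' : EuclideanSpace ℝ ι), (∀ p ∈ X, ∀ x ∈ cell p, ψ x = ψ' x) → f X (ω + ψ) = f X (ω + ψ')) (Y : Finset V) :
    Measurable[⨆ p ∈ Y, MeasurableSpace.comap (fun (ω : EuclideanSpace ℝ ι) (x : cell p) => ω x) inferInstance]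
      (fun ψ : EuclideanSpace ℝ ι =>
        ∑ 𝒞 ∈ ((rconnSubsets (Touches R) 𝒳).image fun 𝒜 => 𝒜.biUnion id).powerset with 𝒞.biUnion id = Y,
          truncatedWeight (GeomInc R) (pushforwardActivity (fun 𝒜 : Finset (Finset V) => 𝒜.biUnion id)
            (cellActivity μ fun X ω => f X (ω + ψ)) (rconnSubsets (Touches R) 𝒳)) 𝒞) := by
  -- `K⁺_Y(ψ) = K⁺_Y(ψ^Y)` by locality, and `ψ ↦ ψ^Y` is measurable in the cells of `Y`
  have hfun : (fun ψ : EuclideanSpace ℝ ι =>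
      ∑ 𝒞 ∈ ((rconnSubsets (Touches R) 𝒳).image fun 𝒜 => 𝒜.biUnion id).powerset with 𝒞.biUnion id = Y,
        truncatedWeight (GeomInc R) (pushforwardActivity (fun 𝒜 : Finset (Finset V) => 𝒜.biUnion id)
          (cellActivity μ fun X ω => f X (ω + ψ)) (rconnSubsets (Touches R) 𝒳)) 𝒞) =
      (fun φ : EuclideanSpace ℝ ι =>
        ∑ 𝒞 ∈ ((rconnSubsets (Touches R) 𝒳).image fun 𝒜 => 𝒜.biUnion id).powerset with 𝒞.biUnion id = Y,
          truncatedWeight (GeomInc R) (pushforwardActivity (fun 𝒜 : Finset (Finset V) => 𝒜.biUnion id)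
            (cellActivity μ fun X ω => f X (ω + φ)) (rconnSubsets (Touches R) 𝒳)) 𝒞) ∘
      (fun ψ : EuclideanSpace ℝ ι => (WithLp.toLp 2 (fun x => if x ∈ Y.biUnion cell then ψ x else 0) : EuclideanSpace ℝ ι)) := by
    funext ψ
    exact step_supportTerm_local (R := R) μ cell 𝒳 hloc Y (cutoffField_eq_on cell Y ψ)
  rw [hfun]
  exact (measurable_supportTerm (R := R) μ hf 𝒳 Y).comp (measurable_cutoffField cell Y)

/-- **The next Mayer factor is measurable in the cells of its support.** [folklore] -/
theorem measurable_nextFactor_cells (μ : Measure (EuclideanSpace ℝ ι)) [SFinite μ] (cell : V → Finset ι)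
    {f : Finset V → EuclideanSpace ℝ ι → ℂ} (hf : ∀ X, Measurable (f X)) (𝒳 : Finset (Finset V))
    (hloc : ∀ X ∈ 𝒳, ∀ (ω ψ ψ' : EuclideanSpace ℝ ι), (∀ p ∈ X, ∀ x ∈ cell p, ψ x = ψ' x) → f X (ω + ψ) = f X (ω + ψ')) (Y : Finset V) :
    Measurable[⨆ p ∈ Y, MeasurableSpace.comap (fun (ω : EuclideanSpace ℝ ι) (x : cell p) => ω x) inferInstance]
      (fun ψ : EuclideanSpace ℝ ι => Complex.exp
        (∑ 𝒞 ∈ ((rconnSubsets (Touches R) 𝒳).image fun 𝒜 => 𝒜.biUnion id).powerset with 𝒞.biUnion id = Y,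
          truncatedWeight (GeomInc R) (pushforwardActivity (fun 𝒜 : Finset (Finset V) => 𝒜.biUnion id)
            (cellActivity μ fun X ω => f X (ω + ψ)) (rconnSubsets (Touches R) 𝒳)) 𝒞) - 1) :=
  (Complex.measurable_exp.comp (measurable_supportTerm_cells (R := R) μ cell hf 𝒳 hloc Y)).sub measurable_const

/-! ## §3. Toy -/

omit [DecidableEq V] [DecidableRel R] [Fintype ι] in
/-- Toy (§2): the cut-off to NO cells (`Y = ∅`) is measurable for the trivial join (it is the constant zero field). -/
example (cell : V → Finset ι) :
    Measurable[⨆ p ∈ (∅ : Finset V), MeasurableSpace.comap (fun (ω : EuclideanSpace ℝ ι) (x : cell p) => ω x) inferInstance]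
      (fun ψ : EuclideanSpace ℝ ι => (WithLp.toLp 2 (fun x => if x ∈ (∅ : Finset V).biUnion cell then ψ x else 0) : EuclideanSpace ℝ ι)) :=
  measurable_cutoffField cell ∅

end Summit.QuantumFields.BalabanUV.T4Continuum.NE7b.SupRoadSupportTermMeasurable
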